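import Literature.NumberTheory.Sieve.MatomakiRadziwillLemma14
import Literature.NumberTheory.Sieve.MatomakiRadziwillTheorem3
import HarnessLib

/-!
# Möbius on shifted primes — the Parseval bound (Lichtman 2020, Lemma 4.6), proved

Topic `Literature/NumberTheory/Sieve`, part of the decomposition of the named fact
`Literature.NumberTheory.Sieve.lichtman2020_moebius_shifted_primes_avg` (J. D. Lichtman, *Averages of
the Möbius function on shifted primes*, Q. J. Math. (2021), doi:10.1093/qmath/haab054,
arXiv:2009.08969 [Lichtman2020], Theorem 1.1).  Page numbers refer to the held copy
`paper:arxiv-2009.08969`.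

Lemma 4.6 of the paper (p. 12) is the Parseval-type bound of Matomäki–Radziwiłł (Ann. of Math. 183
(2016), Lemma 14) "with `(log X)^{1/15}` replaced by general `T₀`": "Given
`T₀ ∈ [(log X)^{1/15}, X^{1/4}]`, and take a sequence `(a_m)` with `|a_m| ≤ 1`. Assume
`1 ≤ h₁ ≤ h₂ ≤ X/T₀³`. For `x ∈ [X, 2X]`, define `S_j(x) = ∑_{x ≤ m ≤ x+h_j} a_m` and
`A(s) = ∑_{X ≤ m ≤ 4X} a_m m^{-s}`. Then
`(1/X) ∫_X^{2X} |S₁(x)/h₁ - S₂(x)/h₂|² dx ≪ 1/T₀ + ∫_{T₀}^{X/h₁} |A(1+it)|² dt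
  + max_{T ≥ X/h₁} (X/h₁)/T ∫_T^{2T} |A(1+it)|² dt`.  Proof. This follows as in [MR] with
`(log X)^{1/15}` replaced by general `T₀`."

This file PROVES it, for **real** sequences, by re-running the bookkeeping of the tree's proof of
Matomäki–Radziwiłł's Lemma 14 (`MatomakiRadziwill2016_lemma14_real_holds`,
`MatomakiRadziwillLemma14.lean`, whose harmonic analysis in
`Literature/NumberTheory/LFunctions/DirichletPolynomialShortWindows.lean` is already written for a
general frequency cutoff `τ`) with `τ = T₀/2π` and a general `h₂ ≤ X/T₀³`:

* `Lichtman2020.parseval_bound_real` — for `|a_m| ≤ 1` real, `X ≥ 1`, `T₀ ≥ 1`,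
  `1 ≤ h₁ ≤ h₂ ≤ X/T₀³`:
  `X⁻¹ ∫_X^{2X} (S₁/h₁ - S₂/h₂)² ≤ 12·2431² (1/T₀² + ∫_{T₀}^{X/h₁} |A(1+it)|² dt + S)`, where
  `S = MatomakiRadziwillL14.Ssup X a (X/h₁) = sup_{T ≥ X/h₁} (X/h₁)/T ∫_T^{2T} |A(1+it)|² dt` and
  `A = MatomakiRadziwillL14.Apoly X a`, `A(t) = ∑_{m ∈ [⌈X⌉, ⌊4X⌋]} a_m m^{-1-it}`.
* `Lichtman2020.parseval_bound_complex` — the same for COMPLEX `‖a_m‖ ≤ 1`, with the two-sided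
  frequency side `|A(1+it)|² + |Ā(1+it)|²` (`Ā` = conjugate coefficients), by splitting into real and
  imaginary parts.
* `Lichtman2020.Ssup_le_of_forall_le` — the `max` term is bounded by any common bound of its members.

## Faithfulness notes

* As for Lemma 14 itself (see the docstring of `MatomakiRadziwill2016_lemma14_real` in
  `MatomakiRadziwill.lean`), the one-sided frequency range `t ≥ T₀` controls the left-hand side only
  for REAL `a_m` (`|A(1-it)| = |A(1+it)|`); Lichtman applies the lemma (p. 14) to
  `a_m = λ(m)χ(m)𝟙_{S_d}(m)`, complex when `χ` is, and the deduction of his Proposition 3.4 in the tree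
  accordingly splits `a_m` into real and imaginary parts and uses Proposition 5.1 for `χ` and `χ̄`.
* The printed error term `1/T₀` is obtained here in the stronger form `1/T₀²` (MR's `(log X)^{-2/15}`
  at `T₀ = (log X)^{1/15}`); the printed side conditions `T₀ ≥ (log X)^{1/15}`, `T₀ ≤ X^{1/4}` are not
  needed (only `T₀ ≥ 1`, `X ≥ 1`); the implied constant is the explicit `12 · 2431²`.

## Sources

* J. D. Lichtman, arXiv:2009.08969, §4, Lemma 4.6 (p. 12); used on p. 14 with `T₀ = (log X)^{2B}`.
* K. Matomäki, M. Radziwiłł, Ann. of Math. (2) 183 (2016), §7, Lemma 14 [MatomakiRadziwillAnnals2016].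
-/

noncomputable section

open MeasureTheory Real Finset Set Filter
open Literature.NumberTheory.LFunctions.WindowPlancherel

namespace Literature.NumberTheory.Sieve

namespace Lichtman2020

open MatomakiRadziwillL14

/-- The `max` term `S = sup_{T ≥ U₁} (U₁/T) ∫_T^{2T} |A|²` is at most any common bound of its
members. [folklore] -/
theorem Ssup_le_of_forall_le (X : ℝ) (a : ℕ → ℝ) {U₁ M : ℝ}
    (hM : ∀ T : ℝ, U₁ ≤ T → U₁ / T * ∫ t in T..2 * T, ‖Apoly X a t‖ ^ 2 ≤ M) :
    Ssup X a U₁ ≤ M := by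
  haveI : Nonempty (Set.Ici U₁) := ⟨⟨U₁, Set.self_mem_Ici⟩⟩
  exact ciSup_le fun T => hM T T.2

/-- **Lichtman 2020, Lemma 4.6 (Parseval bound), for real sequences, proved.**  For a real sequence
`|a_m| ≤ 1`, `X ≥ 1`, `T₀ ≥ 1` and `1 ≤ h₁ ≤ h₂ ≤ X/T₀³`,
`X⁻¹ ∫_X^{2X} (h₁⁻¹ S₁(x) - h₂⁻¹ S₂(x))² dx ≤ 12·2431² (T₀⁻² + ∫_{T₀}^{X/h₁} |A(1+it)|² dt + S)`,
`S_j(x) = ∑_{x ≤ m ≤ x + h_j} a_m` (integers of `[x, x+h_j]` = `Icc ⌈x⌉₊ ⌊x+h_j⌋₊`),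
`A(1+it) = ∑_{X ≤ m ≤ 4X} a_m m^{-1-it}` (`MatomakiRadziwillL14.Apoly`) and
`S = sup_{T ≥ X/h₁} (X/h₁)/T ∫_T^{2T} |A(1+it)|² dt` (`MatomakiRadziwillL14.Ssup`).  The argument is
that of `MatomakiRadziwill2016_lemma14_real_holds` with the cutoff `τ = T₀/2π`: the low-frequency
parts cancel up to `3 (K(h₁+h₂)/X)² X ≤ 12·2431² T₀⁴ h₂²/X ≤ 12·2431² X/T₀²` (`K ≤ 2431 τ'²`,
`τ' ≤ T₀`, `h₂ ≤ X/T₀³`), and each high-frequency energy is `≤ 640 X (I₁ + S)`.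
[cite: Lichtman2020, Lemma 4.6] -/
theorem parseval_bound_real {a : ℕ → ℝ} (ha : ∀ m, |a m| ≤ 1) {X T₀ h₁ h₂ : ℝ}
    (hX : 1 ≤ X) (hT₀ : 1 ≤ T₀) (hh₁ : 1 ≤ h₁) (hh₁₂ : h₁ ≤ h₂) (hh₂ : h₂ ≤ X / T₀ ^ 3) :
    X⁻¹ * ∫ x in X..2 * X,
        (h₁⁻¹ * ∑ m ∈ Icc ⌈x⌉₊ ⌊x + h₁⌋₊, a m - h₂⁻¹ * ∑ m ∈ Icc ⌈x⌉₊ ⌊x + h₂⌋₊, a m) ^ 2 ≤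
      12 * 2431 ^ 2 *
        (1 / T₀ ^ 2 + (∫ t in T₀..X / h₁, ‖Apoly X a t‖ ^ 2) + Ssup X a (X / h₁)) := by
  have hX0 : 0 < X := by linarith
  have hT₀0 : 0 < T₀ := by linarith
  have hT₀3 : T₀ ≤ T₀ ^ 3 := by
    calc T₀ = T₀ ^ 1 := (pow_one T₀).symm
      _ ≤ T₀ ^ 3 := pow_le_pow_right₀ hT₀ (by norm_num)
  have hT₀31 : 1 ≤ T₀ ^ 3 := hT₀.trans hT₀3
  have hh₂1 : 1 ≤ h₂ := hh₁.trans hh₁₂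
  have hh₂0 : 0 < h₂ := by linarith
  have hh₂X : h₂ ≤ X := hh₂.trans (div_le_self hX0.le hT₀31)
  -- `X / h₂ ≥ T₀³ ≥ T₀`
  have hT₀U₂ : T₀ ≤ X / h₂ := by
    have h1 : X / (X / T₀ ^ 3) ≤ X / h₂ := div_le_div_of_nonneg_left hX0.le hh₂0 hh₂
    have h2 : X / (X / T₀ ^ 3) = T₀ ^ 3 := by field_simp
    rw [h2] at h1
    exact hT₀3.trans h1
  have hT₀U₁ : T₀ ≤ X / h₁ := hT₀U₂.trans (div_le_div_of_nonneg_left hX0.le (by linarith) hh₁₂)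
  set τ := T₀ / (2 * π) with hτ
  have h2π : (0 : ℝ) < 2 * π := by positivity
  have hT₀τ : T₀ ≤ 2 * π * cutoffRadius τ := by
    have : τ ≤ cutoffRadius τ := le_max_left _ _
    calc T₀ = 2 * π * τ := by rw [hτ]; field_simp
      _ ≤ 2 * π * cutoffRadius τ := mul_le_mul_of_nonneg_left this h2π.le
  have hrad : cutoffRadius τ ≤ T₀ := by
    refine max_le ?_ hT₀
    rw [hτ, div_le_iff₀ h2π]
    nlinarith [Real.pi_gt_three]
  -- the `y`-integral and the energy bounds
  have hmain := MatomakiRadziwillL14.setIntegral_sq_sub_le ha hX τ hh₁ (by linarith) hh₂1 (by linarith)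
  have hP₁ := MatomakiRadziwillL14.Pbound_le X hX ha (τ := τ) (h := h₁) hT₀ hT₀τ hh₁ le_rfl hT₀U₁
  have hP₂ := MatomakiRadziwillL14.Pbound_le X hX ha (τ := τ) (h := h₂) hT₀ hT₀τ hh₁ hh₁₂ hT₀U₂
  set I₁ := ∫ t in T₀..X / h₁, ‖MatomakiRadziwillL14.Apoly X a t‖ ^ 2 with hI₁
  set S := MatomakiRadziwillL14.Ssup X a (X / h₁) with hS
  have hI₁0 : 0 ≤ I₁ := intervalIntegral.integral_nonneg hT₀U₁ fun t _ => sq_nonneg _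
  have hS0 : 0 ≤ S := MatomakiRadziwillL14.Ssup_nonneg X a (by positivity)
  have hE₁ := MatomakiRadziwillL14.energy_term_le (I := I₁) (S := S) hX0 (by linarith) (hh₁₂.trans hh₂X)
    (MatomakiRadziwillL14.thetaB_le hX0 (by linarith)) (add_nonneg hI₁0 hS0)
    (MatomakiRadziwillL14.Pbound_nonneg X a τ h₁) hP₁
  have hE₂ := MatomakiRadziwillL14.energy_term_le (I := I₁) (S := S) hX0 (by linarith) hh₂X
    (MatomakiRadziwillL14.thetaB_le hX0 (by linarith)) (add_nonneg hI₁0 hS0)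
    (MatomakiRadziwillL14.Pbound_nonneg X a τ h₂) hP₂
  -- the first (`U`-part) term: `3 (K(h₁+h₂)/X)² X ≤ 12·2431² X / T₀²`
  have hK := MatomakiRadziwillL14.Kconst_le τ
  have hK0 := (MatomakiRadziwillL14.Kconst_pos τ).le
  have hrad0 := (cutoffRadius_pos τ).le
  have hpow : T₀ ^ 4 * h₂ ^ 2 / X ≤ X / T₀ ^ 2 := by
    have h1 : T₀ ^ 3 * h₂ ≤ X := by
      rw [← le_div_iff₀' (by positivity)]; exact hh₂
    have h0 : 0 ≤ T₀ ^ 3 * h₂ := by positivity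
    rw [div_le_div_iff₀ hX0 (by positivity)]
    nlinarith [mul_le_mul h1 h1 h0 hX0.le]
  have hfirst : 3 * (MatomakiRadziwillL14.Kconst τ * ((h₁ + h₂) / X)) ^ 2 * X ≤
      12 * 2431 ^ 2 * (X / T₀ ^ 2) := by
    have h1 : MatomakiRadziwillL14.Kconst τ ≤ 2431 * T₀ ^ 2 :=
      hK.trans (mul_le_mul_of_nonneg_left (pow_le_pow_left₀ hrad0 hrad 2) (by norm_num))
    have h2 : (h₁ + h₂) / X ≤ 2 * h₂ / X := div_le_div_of_nonneg_right (by linarith) hX0.le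
    have h3 : MatomakiRadziwillL14.Kconst τ * ((h₁ + h₂) / X) ≤ 2431 * T₀ ^ 2 * (2 * h₂ / X) :=
      mul_le_mul h1 h2 (by positivity) (by positivity)
    calc 3 * (MatomakiRadziwillL14.Kconst τ * ((h₁ + h₂) / X)) ^ 2 * X
        ≤ 3 * (2431 * T₀ ^ 2 * (2 * h₂ / X)) ^ 2 * X := by gcongr
      _ = 12 * 2431 ^ 2 * (T₀ ^ 4 * h₂ ^ 2 / X) := by field_simp; ring
      _ ≤ 12 * 2431 ^ 2 * (X / T₀ ^ 2) := mul_le_mul_of_nonneg_left hpow (by norm_num)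
  -- assemble
  rw [intervalIntegral.integral_of_le (by linarith : X ≤ 2 * X)]
  change X⁻¹ * ∫ x in Set.Ioc X (2 * X), (h₁⁻¹ * ∑ m ∈ Finset.Icc ⌈x⌉₊ ⌊x + h₁⌋₊, a m
      - h₂⁻¹ * ∑ m ∈ Finset.Icc ⌈x⌉₊ ⌊x + h₂⌋₊, a m) ^ 2
    ≤ 12 * 2431 ^ 2 * (1 / T₀ ^ 2 + I₁ + S)
  have htot : ∫ x in Set.Ioc X (2 * X), (h₁⁻¹ * ∑ m ∈ Finset.Icc ⌈x⌉₊ ⌊x + h₁⌋₊, a m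
      - h₂⁻¹ * ∑ m ∈ Finset.Icc ⌈x⌉₊ ⌊x + h₂⌋₊, a m) ^ 2
      ≤ 12 * 2431 ^ 2 * (X / T₀ ^ 2) + 1280 * X * (I₁ + S) := by
    linarith
  rw [← div_eq_inv_mul, div_le_iff₀ hX0]
  have hIS : 1280 * X * (I₁ + S) ≤ 12 * 2431 ^ 2 * X * (I₁ + S) :=
    mul_le_mul_of_nonneg_right (mul_le_mul_of_nonneg_right (by norm_num) hX0.le) (add_nonneg hI₁0 hS0)
  calc ∫ x in Set.Ioc X (2 * X), (h₁⁻¹ * ∑ m ∈ Finset.Icc ⌈x⌉₊ ⌊x + h₁⌋₊, a m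
        - h₂⁻¹ * ∑ m ∈ Finset.Icc ⌈x⌉₊ ⌊x + h₂⌋₊, a m) ^ 2
      ≤ 12 * 2431 ^ 2 * (X / T₀ ^ 2) + 12 * 2431 ^ 2 * X * (I₁ + S) := htot.trans (by linarith)
    _ = 12 * 2431 ^ 2 * (1 / T₀ ^ 2 + I₁ + S) * X := by
        field_simp
        ring


/-! ### Window sums are bounded measurable step functions -/

/-- A measurable function bounded on `(X, Y]` is interval integrable on `[X, Y]` (`X ≤ Y`). [folklore] -/
theorem intervalIntegrable_of_norm_le {E : Type*} [NormedAddCommGroup E] [MeasurableSpace E]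
    [BorelSpace E] [SecondCountableTopology E] {f : ℝ → E} (hf : Measurable f) {X Y B : ℝ}
    (hXY : X ≤ Y) (hB : ∀ x ∈ Set.Ioc X Y, ‖f x‖ ≤ B) : IntervalIntegrable f volume X Y := by
  rw [intervalIntegrable_iff, Set.uIoc_of_le hXY]
  refine Measure.integrableOn_of_bounded (M := B) (by simp [Real.volume_Ioc]) hf.aestronglyMeasurable ?_
  exact (ae_restrict_iff' measurableSet_Ioc).2 (Eventually.of_forall hB)

/-- The normalised two-window difference `x ↦ h₁⁻¹ S₁(x) - h₂⁻¹ S₂(x)` of a bounded complex sequence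
has interval integrable squared norm on `[X, 2X]` (`X ≥ 0`, `h_j ≥ 1`; from
`MatomakiRadziwillThm3.integrableOn_parseval`). [folklore] -/
theorem intervalIntegrable_norm_sq_windowDiff {a : ℕ → ℂ} (ha : ∀ m, ‖a m‖ ≤ 1) {X h₁ h₂ : ℝ}
    (hX : 0 ≤ X) (hh₁ : 1 ≤ h₁) (hh₂ : 1 ≤ h₂) :
    IntervalIntegrable (fun x : ℝ =>
      ‖(h₁ : ℂ)⁻¹ * ∑ m ∈ Icc ⌈x⌉₊ ⌊x + h₁⌋₊, a m - (h₂ : ℂ)⁻¹ * ∑ m ∈ Icc ⌈x⌉₊ ⌊x + h₂⌋₊, a m‖ ^ 2)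
      volume X (2 * X) := by
  rw [intervalIntegrable_iff, Set.uIoc_of_le (by linarith)]
  exact MatomakiRadziwillThm3.integrableOn_parseval ha hh₁ hh₂ hX

/-! ### Complex sequences: reduction to the real case -/

/-- The Dirichlet polynomial `A(1+it) = ∑_{X ≤ m ≤ 4X} a_m m^{-1-it}` of a COMPLEX sequence
(`MatomakiRadziwillL14.Apoly` is its real-sequence case). [folklore] -/
def ApolyC (X : ℝ) (a : ℕ → ℂ) (t : ℝ) : ℂ :=
  ∑ m ∈ suppM X, a m * (m : ℂ) ^ (-(1 + (t : ℂ) * Complex.I))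

/-- `A` is continuous in `t`. [folklore] -/
theorem continuous_ApolyC (X : ℝ) (hX : 1 ≤ X) (a : ℕ → ℂ) : Continuous (ApolyC X a) := by
  unfold ApolyC
  refine continuous_finsetSum _ fun m hm => continuous_const.mul ?_
  have hm1 : 1 ≤ m := one_le_of_mem_suppM hX hm
  exact continuous_const.cpow (continuous_const.add (Complex.continuous_ofReal.mul continuous_const)).neg
    fun _ => Or.inl (by exact_mod_cast hm1)

/-- The polynomial of the real part: `A[Re a] = (A[a] + A[ā])/2`. [folklore] -/
theorem Apoly_re_eq (X : ℝ) (a : ℕ → ℂ) (t : ℝ) :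
    Apoly X (fun m => (a m).re) t = (ApolyC X a t + ApolyC X (fun m => star (a m)) t) / 2 := by
  simp only [Apoly, ApolyC, ← Finset.sum_add_distrib, Finset.sum_div, ← add_mul]
  refine Finset.sum_congr rfl fun m _ => ?_
  rw [Complex.re_eq_add_conj, mul_div_right_comm]
  rfl

/-- The polynomial of the imaginary part: `A[Im a] = (A[a] - A[ā])/(2i)`. [folklore] -/
theorem Apoly_im_eq (X : ℝ) (a : ℕ → ℂ) (t : ℝ) :
    Apoly X (fun m => (a m).im) t =
      (ApolyC X a t - ApolyC X (fun m => star (a m)) t) / (2 * Complex.I) := by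
  simp only [Apoly, ApolyC, ← Finset.sum_sub_distrib, Finset.sum_div, ← sub_mul]
  refine Finset.sum_congr rfl fun m _ => ?_
  rw [Complex.im_eq_sub_conj, mul_div_right_comm]
  rfl

/-- `‖(p ± q)/c‖² ≤ (‖p‖² + ‖q‖²)/2` when `‖c‖ = 2`. [folklore] -/
theorem norm_sq_half_combination_le (p q c : ℂ) (hc : ‖c‖ = 2) (ε : ℂ) (hε : ‖ε‖ = 1) :
    ‖(p + ε * q) / c‖ ^ 2 ≤ (‖p‖ ^ 2 + ‖q‖ ^ 2) / 2 := by
  rw [norm_div, hc]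
  have h1 : ‖p + ε * q‖ ≤ ‖p‖ + ‖q‖ := by
    calc ‖p + ε * q‖ ≤ ‖p‖ + ‖ε * q‖ := norm_add_le _ _
      _ = ‖p‖ + ‖q‖ := by rw [norm_mul, hε, one_mul]
  have h0 : 0 ≤ ‖p + ε * q‖ := norm_nonneg _
  rw [div_pow]
  nlinarith [sq_nonneg (‖p‖ - ‖q‖), mul_le_mul h1 h1 h0 (by positivity), norm_nonneg p, norm_nonneg q]

/-- `|A[Re a](t)|² ≤ (|A[a](t)|² + |A[ā](t)|²)/2`. [folklore] -/
theorem norm_sq_Apoly_re_le (X : ℝ) (a : ℕ → ℂ) (t : ℝ) :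
    ‖Apoly X (fun m => (a m).re) t‖ ^ 2 ≤
      (‖ApolyC X a t‖ ^ 2 + ‖ApolyC X (fun m => star (a m)) t‖ ^ 2) / 2 := by
  rw [Apoly_re_eq]
  have := norm_sq_half_combination_le (ApolyC X a t) (ApolyC X (fun m => star (a m)) t) 2
    (by simp) 1 (by simp)
  simpa using this

/-- `|A[Im a](t)|² ≤ (|A[a](t)|² + |A[ā](t)|²)/2`. [folklore] -/
theorem norm_sq_Apoly_im_le (X : ℝ) (a : ℕ → ℂ) (t : ℝ) :
    ‖Apoly X (fun m => (a m).im) t‖ ^ 2 ≤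
      (‖ApolyC X a t‖ ^ 2 + ‖ApolyC X (fun m => star (a m)) t‖ ^ 2) / 2 := by
  rw [Apoly_im_eq]
  have := norm_sq_half_combination_le (ApolyC X a t) (ApolyC X (fun m => star (a m)) t)
    (2 * Complex.I) (by simp) (-1) (by simp)
  simpa [sub_eq_add_neg] using this

/-- Real part of the normalised two-window difference. [folklore] -/
theorem windowDiff_re (a : ℕ → ℂ) (h₁ h₂ x : ℝ) :
    ((h₁ : ℂ)⁻¹ * ∑ m ∈ Icc ⌈x⌉₊ ⌊x + h₁⌋₊, a m - (h₂ : ℂ)⁻¹ * ∑ m ∈ Icc ⌈x⌉₊ ⌊x + h₂⌋₊, a m).re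
      = h₁⁻¹ * ∑ m ∈ Icc ⌈x⌉₊ ⌊x + h₁⌋₊, (a m).re - h₂⁻¹ * ∑ m ∈ Icc ⌈x⌉₊ ⌊x + h₂⌋₊, (a m).re := by
  rw [← Complex.ofReal_inv, ← Complex.ofReal_inv, Complex.sub_re, Complex.re_ofReal_mul,
    Complex.re_ofReal_mul, Complex.re_sum, Complex.re_sum]

/-- Imaginary part of the normalised two-window difference. [folklore] -/
theorem windowDiff_im (a : ℕ → ℂ) (h₁ h₂ x : ℝ) :
    ((h₁ : ℂ)⁻¹ * ∑ m ∈ Icc ⌈x⌉₊ ⌊x + h₁⌋₊, a m - (h₂ : ℂ)⁻¹ * ∑ m ∈ Icc ⌈x⌉₊ ⌊x + h₂⌋₊, a m).im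
      = h₁⁻¹ * ∑ m ∈ Icc ⌈x⌉₊ ⌊x + h₁⌋₊, (a m).im - h₂⁻¹ * ∑ m ∈ Icc ⌈x⌉₊ ⌊x + h₂⌋₊, (a m).im := by
  rw [← Complex.ofReal_inv, ← Complex.ofReal_inv, Complex.sub_im, Complex.im_ofReal_mul,
    Complex.im_ofReal_mul, Complex.im_sum, Complex.im_sum]

/-- **Lichtman 2020, Lemma 4.6 (Parseval bound), for complex sequences.**  For `‖a_m‖ ≤ 1`,
`X ≥ 1`, `T₀ ≥ 1`, `1 ≤ h₁ ≤ h₂ ≤ X/T₀³`, and any `M` with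
`(X/h₁)/T ∫_T^{2T} (|A(1+it)|² + |Ā(1+it)|²) dt ≤ M` for all `T ≥ X/h₁`
(`Ā(s) = ∑ ā_m m^{-s}`, so `|Ā(1+it)| = |A(1-it)|`):
`X⁻¹ ∫_X^{2X} |h₁⁻¹S₁(x) - h₂⁻¹S₂(x)|² dx
  ≤ 12·2431² (2/T₀² + ∫_{T₀}^{X/h₁} (|A(1+it)|² + |Ā(1+it)|²) dt + M)`.
Obtained from `parseval_bound_real` for `Re a_m` and `Im a_m` (`|z|² = (Re z)² + (Im z)²`,
`|A[Re a]|², |A[Im a]|² ≤ (|A|² + |Ā|²)/2`).  This two-sided form is what the lemma gives for the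
complex sequences `a_m = λ(m)χ(m)𝟙_{S_d}(m)` to which the paper applies it (p. 14).
[cite: Lichtman2020, Lemma 4.6] -/
theorem parseval_bound_complex {a : ℕ → ℂ} (ha : ∀ m, ‖a m‖ ≤ 1) {X T₀ h₁ h₂ : ℝ}
    (hX : 1 ≤ X) (hT₀ : 1 ≤ T₀) (hh₁ : 1 ≤ h₁) (hh₁₂ : h₁ ≤ h₂) (hh₂ : h₂ ≤ X / T₀ ^ 3) {M : ℝ}
    (hM : ∀ T : ℝ, X / h₁ ≤ T → (X / h₁) / T * ∫ t in T..2 * T,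
        (‖ApolyC X a t‖ ^ 2 + ‖ApolyC X (fun m => star (a m)) t‖ ^ 2) ≤ M) :
    X⁻¹ * ∫ x in X..2 * X,
        ‖(h₁ : ℂ)⁻¹ * ∑ m ∈ Icc ⌈x⌉₊ ⌊x + h₁⌋₊, a m
          - (h₂ : ℂ)⁻¹ * ∑ m ∈ Icc ⌈x⌉₊ ⌊x + h₂⌋₊, a m‖ ^ 2 ≤
      12 * 2431 ^ 2 * (2 / T₀ ^ 2
        + (∫ t in T₀..X / h₁, (‖ApolyC X a t‖ ^ 2 + ‖ApolyC X (fun m => star (a m)) t‖ ^ 2))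
        + M) := by
  have hX0 : 0 < X := by linarith
  have hh₁0 : 0 < h₁ := by linarith
  have hU0 : 0 < X / h₁ := by positivity
  set u : ℕ → ℝ := fun m => (a m).re with hu
  set v : ℕ → ℝ := fun m => (a m).im with hv
  have hu1 : ∀ m, |u m| ≤ 1 := fun m => (Complex.abs_re_le_norm (a m)).trans (ha m)
  have hv1 : ∀ m, |v m| ≤ 1 := fun m => (Complex.abs_im_le_norm (a m)).trans (ha m)
  set F : ℝ → ℝ := fun t => ‖ApolyC X a t‖ ^ 2 + ‖ApolyC X (fun m => star (a m)) t‖ ^ 2 with hF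
  have hFc : Continuous F := by
    have h1 := continuous_ApolyC X hX a
    have h2 := continuous_ApolyC X hX (fun m => star (a m))
    exact ((continuous_norm.comp h1).pow 2).add ((continuous_norm.comp h2).pow 2)
  have hF0 : ∀ t, 0 ≤ F t := fun t => by positivity
  have hAu : ∀ t, ‖Apoly X u t‖ ^ 2 ≤ F t / 2 := fun t => norm_sq_Apoly_re_le X a t
  have hAv : ∀ t, ‖Apoly X v t‖ ^ 2 ≤ F t / 2 := fun t => norm_sq_Apoly_im_le X a t
  have hcu : Continuous fun t => ‖Apoly X u t‖ ^ 2 := (continuous_norm.comp (continuous_Apoly X hX u)).pow 2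
  have hcv : Continuous fun t => ‖Apoly X v t‖ ^ 2 := (continuous_norm.comp (continuous_Apoly X hX v)).pow 2
  -- the `max` terms of `u`, `v` are `≤ M/2`
  have hint_le : ∀ (w : ℕ → ℝ), (∀ t, ‖Apoly X w t‖ ^ 2 ≤ F t / 2) →
      (Continuous fun t => ‖Apoly X w t‖ ^ 2) → ∀ T₁ T₂ : ℝ, T₁ ≤ T₂ →
      ∫ t in T₁..T₂, ‖Apoly X w t‖ ^ 2 ≤ (∫ t in T₁..T₂, F t) / 2 := by
    intro w hw hc T₁ T₂ hT
    rw [← intervalIntegral.integral_div]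
    exact intervalIntegral.integral_mono_on hT (hc.intervalIntegrable _ _)
      ((hFc.intervalIntegrable _ _).div_const _) fun t _ => hw t
  have hSu : Ssup X u (X / h₁) ≤ M / 2 := by
    refine Ssup_le_of_forall_le X u fun T hT => ?_
    have hT0 : 0 < T := hU0.trans_le hT
    have h1 := hint_le u hAu hcu T (2 * T) (by linarith)
    have h2 := hM T hT
    calc X / h₁ / T * ∫ t in T..2 * T, ‖Apoly X u t‖ ^ 2 ≤ X / h₁ / T * ((∫ t in T..2 * T, F t) / 2) :=
          mul_le_mul_of_nonneg_left h1 (by positivity)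
      _ = (X / h₁ / T * ∫ t in T..2 * T, F t) / 2 := by ring
      _ ≤ M / 2 := by linarith
  have hSv : Ssup X v (X / h₁) ≤ M / 2 := by
    refine Ssup_le_of_forall_le X v fun T hT => ?_
    have hT0 : 0 < T := hU0.trans_le hT
    have h1 := hint_le v hAv hcv T (2 * T) (by linarith)
    have h2 := hM T hT
    calc X / h₁ / T * ∫ t in T..2 * T, ‖Apoly X v t‖ ^ 2 ≤ X / h₁ / T * ((∫ t in T..2 * T, F t) / 2) :=
          mul_le_mul_of_nonneg_left h1 (by positivity)
      _ = (X / h₁ / T * ∫ t in T..2 * T, F t) / 2 := by ring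
      _ ≤ M / 2 := by linarith
  -- `T₀ ≤ X/h₁` or not: the real lemma needs nothing here, but the comparison of `I₁` terms does
  have hPu := parseval_bound_real hu1 hX hT₀ hh₁ hh₁₂ hh₂
  have hPv := parseval_bound_real hv1 hX hT₀ hh₁ hh₁₂ hh₂
  -- compare the `I₁` terms
  have hT₀U₁ : T₀ ≤ X / h₁ := by
    have hT₀0 : 0 < T₀ := by linarith
    have hT₀3 : T₀ ≤ T₀ ^ 3 := by
      calc T₀ = T₀ ^ 1 := (pow_one T₀).symm
        _ ≤ T₀ ^ 3 := pow_le_pow_right₀ hT₀ (by norm_num)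
    have hh₂0 : 0 < h₂ := by linarith
    have h1 : X / (X / T₀ ^ 3) ≤ X / h₂ := div_le_div_of_nonneg_left hX0.le hh₂0 hh₂
    have h2 : X / (X / T₀ ^ 3) = T₀ ^ 3 := by field_simp
    rw [h2] at h1
    exact (hT₀3.trans h1).trans (div_le_div_of_nonneg_left hX0.le hh₁0 hh₁₂)
  have hIu := hint_le u hAu hcu T₀ (X / h₁) hT₀U₁
  have hIv := hint_le v hAv hcv T₀ (X / h₁) hT₀U₁
  -- the left-hand sides: `|D|² = D[u]² + D[v]²`
  have hsplit : ∀ x : ℝ,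
      ‖(h₁ : ℂ)⁻¹ * ∑ m ∈ Icc ⌈x⌉₊ ⌊x + h₁⌋₊, a m - (h₂ : ℂ)⁻¹ * ∑ m ∈ Icc ⌈x⌉₊ ⌊x + h₂⌋₊, a m‖ ^ 2
        = (h₁⁻¹ * ∑ m ∈ Icc ⌈x⌉₊ ⌊x + h₁⌋₊, u m - h₂⁻¹ * ∑ m ∈ Icc ⌈x⌉₊ ⌊x + h₂⌋₊, u m) ^ 2
          + (h₁⁻¹ * ∑ m ∈ Icc ⌈x⌉₊ ⌊x + h₁⌋₊, v m - h₂⁻¹ * ∑ m ∈ Icc ⌈x⌉₊ ⌊x + h₂⌋₊, v m) ^ 2 := by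
    intro x
    rw [Complex.sq_norm, Complex.normSq_apply, windowDiff_re, windowDiff_im]
    simp only [hu, hv]
    ring
  have hIntu : IntervalIntegrable (fun x : ℝ =>
      (h₁⁻¹ * ∑ m ∈ Icc ⌈x⌉₊ ⌊x + h₁⌋₊, u m - h₂⁻¹ * ∑ m ∈ Icc ⌈x⌉₊ ⌊x + h₂⌋₊, u m) ^ 2)
      volume X (2 * X) := by
    have h := intervalIntegrable_norm_sq_windowDiff (a := fun m => ((u m : ℝ) : ℂ))
      (fun m => by rw [Complex.norm_real]; exact hu1 m) hX0.le hh₁ (hh₁.trans hh₁₂)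
    refine h.congr fun x _ => ?_
    rw [Complex.sq_norm, Complex.normSq_apply, windowDiff_re, windowDiff_im]
    simp [sq]
  have hIntv : IntervalIntegrable (fun x : ℝ =>
      (h₁⁻¹ * ∑ m ∈ Icc ⌈x⌉₊ ⌊x + h₁⌋₊, v m - h₂⁻¹ * ∑ m ∈ Icc ⌈x⌉₊ ⌊x + h₂⌋₊, v m) ^ 2)
      volume X (2 * X) := by
    have h := intervalIntegrable_norm_sq_windowDiff (a := fun m => ((v m : ℝ) : ℂ))
      (fun m => by rw [Complex.norm_real]; exact hv1 m) hX0.le hh₁ (hh₁.trans hh₁₂)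
    refine h.congr fun x _ => ?_
    rw [Complex.sq_norm, Complex.normSq_apply, windowDiff_re, windowDiff_im]
    simp [sq]
  have hLHS : ∫ x in X..2 * X,
      ‖(h₁ : ℂ)⁻¹ * ∑ m ∈ Icc ⌈x⌉₊ ⌊x + h₁⌋₊, a m - (h₂ : ℂ)⁻¹ * ∑ m ∈ Icc ⌈x⌉₊ ⌊x + h₂⌋₊, a m‖ ^ 2
      = (∫ x in X..2 * X,
          (h₁⁻¹ * ∑ m ∈ Icc ⌈x⌉₊ ⌊x + h₁⌋₊, u m - h₂⁻¹ * ∑ m ∈ Icc ⌈x⌉₊ ⌊x + h₂⌋₊, u m) ^ 2)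
        + ∫ x in X..2 * X,
          (h₁⁻¹ * ∑ m ∈ Icc ⌈x⌉₊ ⌊x + h₁⌋₊, v m - h₂⁻¹ * ∑ m ∈ Icc ⌈x⌉₊ ⌊x + h₂⌋₊, v m) ^ 2 := by
    rw [← intervalIntegral.integral_add hIntu hIntv]
    exact intervalIntegral.integral_congr fun x _ => hsplit x
  rw [hLHS, mul_add]
  have h1 : 12 * 2431 ^ 2 * (1 / T₀ ^ 2 + (∫ t in T₀..X / h₁, ‖Apoly X u t‖ ^ 2) + Ssup X u (X / h₁))
      ≤ 12 * 2431 ^ 2 * (1 / T₀ ^ 2 + (∫ t in T₀..X / h₁, F t) / 2 + M / 2) := by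
    gcongr
  have h2 : 12 * 2431 ^ 2 * (1 / T₀ ^ 2 + (∫ t in T₀..X / h₁, ‖Apoly X v t‖ ^ 2) + Ssup X v (X / h₁))
      ≤ 12 * 2431 ^ 2 * (1 / T₀ ^ 2 + (∫ t in T₀..X / h₁, F t) / 2 + M / 2) := by
    gcongr
  have h3 := (add_le_add hPu hPv).trans (add_le_add h1 h2)
  refine h3.trans (le_of_eq ?_)
  ring

end Lichtman2020

end Literature.NumberTheory.Sieve
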